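import Summits.CriticalPhenomena.PercolationContinuityZ3.Theorems.PercNearOneGluingNoHeavyLowerTailConditionedChampionExchange
import Summits.CriticalPhenomena.PercolationContinuityZ3.Theorems.PercNearOneGluingNoHeavyLowerTailPrefixPackingTwo
import HarnessLib

/-!
# `NoHeavyLowerTail` (stmt-CriticalPhenomena-4575) — OBSERVER LIGHTNESS: an observer hanging on a set of relays is light no more
# often than the lightest of them (pair case proved; general case reduced to the restricted-attachment exchange)

Support file (lemma factory #8 `prim-lf-8`, gen 7; `--supports stmt-CriticalPhenomena-4575`).  No definitions, no named facts,
no sorries.  `μ = prodBernoulli w`, relays `A`, level `j`, `R_v = {|π(v)| ≤ j}`, `S(v) = μ(R_v)`, `E_Q = {o ↔ Q} = ⋃_{x∈Q} {o↔x}`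
for `Q ⊆ A`.

* `ObserverLightness.observer_le_lightest_of_rex` — for `x ∈ Q ⊆ A`, GIVEN the restricted-attachment exchange REX(`Q ∖ x`; `x`) for this
  graph (`μ({o↔Q∖x}, 1≤|π(o)|≤j, |π(x)|>j) ≤ μ({o↔Q∖x}, |π(o)|>j, |π(x)|≤j)`, see `…RestrictedAttachmentExchange.lean`):
  `μ(E_Q ∩ R_o) ≤ μ(E_Q ∩ R_x)` — jointly with its attachment to `Q`, the observer's block is light no more often than `x`'s;
  `observerLight_of_rex`: then `μ(E_Q ∩ R_o) ≤ μ(E_Q) · S(x)` by Harris (`E_Q` increasing, `R_x` decreasing).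
* `observer_le_lightest_pair`, `observerLight_pair` — the case `Q = {x, b}` with `S(b) ≤ S(x)` is UNCONDITIONAL, because REX(`{b}`; `x`) is
  the conditioned championship exchange (`conditionedChampionExchange_swap`):  **`μ(E_{x,b} ∩ R_o) ≤ μ(E_{x,b}) · S(x)`**, i.e.
  `P(|π(o)| ≤ j | o ↔ {x,b}) ≤ max(S(x), S(b))` (Harris alone only gives `≤ P(|π(o)| ≤ j)`, which counts the unattached observer).
So OBSMAX(|Q|) ⟸ REX(|Q|−1), with REX(1) a theorem.  Seat census of `P(o light | o ↔ Q) ≤ max_{x∈Q} S(x)`: 0 / 10 569 exact cases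
(all cells `|A| ≤ 7`, `|Q| ≤ 4`) + climbs (prim-lf-8 CANDIDATES v8 B8-7).
-/

noncomputable section

namespace Summit.CriticalPhenomena.PercolationContinuityZ3.Theorems

open MeasureTheory Set Literature.Probability.LatticeModels Literature.Probability.Percolation
open scoped Classical BigOperators

variable {n : ℕ}

namespace ObserverLightness

open ConditionedChampionExchange

/-- `{o ↔ Q} = {∃ y ∈ Q, o ↔ y}` is an upper set of configurations. [folklore] -/
theorem isUpperSet_attached (Q : Finset (Fin n)) (o : Fin n) :
    IsUpperSet {ω : BondConfig (Fin n) | ∃ y ∈ Q, ω ∈ (openConn o y : Set (BondConfig (Fin n)))} := by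
  rintro ω ω' hle ⟨y, hy, h⟩
  exact ⟨y, hy, isUpperSet_openConn o y hle h⟩

/-- **Observer lightness from the restricted-attachment exchange.**  For `x ∈ Q ⊆ A`, REX(`Q ∖ x`; `x`) for this graph gives
`μ(E_Q ∩ R_o) ≤ μ(E_Q ∩ R_x)`. [this work] -/
theorem observer_le_lightest_of_rex (w : Sym2 (Fin n) → unitInterval) (A Q : Finset (Fin n)) (o x : Fin n) (j : ℕ)
    (hQA : Q ⊆ A) (hx : x ∈ Q)
    (hREX : (prodBernoulli w).real ({ω : BondConfig (Fin n) | ∃ y ∈ Q.erase x, ω ∈ (openConn o y : Set (BondConfig (Fin n)))} ∩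
          {ω | 1 ≤ (A.filter fun a => ω ∈ openConn o a).card ∧ (A.filter fun a => ω ∈ openConn o a).card ≤ j} ∩
          {ω | j < (A.filter fun a => ω ∈ openConn x a).card}) ≤
      (prodBernoulli w).real ({ω : BondConfig (Fin n) | ∃ y ∈ Q.erase x, ω ∈ (openConn o y : Set (BondConfig (Fin n)))} ∩
          {ω | j < (A.filter fun a => ω ∈ openConn o a).card} ∩
          {ω | (A.filter fun a => ω ∈ openConn x a).card ≤ j})) :
    (prodBernoulli w).real ({ω : BondConfig (Fin n) | ∃ y ∈ Q, ω ∈ (openConn o y : Set (BondConfig (Fin n)))} ∩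
        {ω | (A.filter fun a => ω ∈ openConn o a).card ≤ j}) ≤
      (prodBernoulli w).real ({ω : BondConfig (Fin n) | ∃ y ∈ Q, ω ∈ (openConn o y : Set (BondConfig (Fin n)))} ∩
        {ω | (A.filter fun a => ω ∈ openConn x a).card ≤ j}) := by
  set μ := prodBernoulli w with hμ
  set E : Set (BondConfig (Fin n)) := {ω | ∃ y ∈ Q, ω ∈ (openConn o y : Set (BondConfig (Fin n)))} with hE
  set E' : Set (BondConfig (Fin n)) := {ω | ∃ y ∈ Q.erase x, ω ∈ (openConn o y : Set (BondConfig (Fin n)))} with hE'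
  set Lo : Set (BondConfig (Fin n)) := {ω | (A.filter fun a => ω ∈ openConn o a).card ≤ j} with hLo
  set Lo1 : Set (BondConfig (Fin n)) := {ω | 1 ≤ (A.filter fun a => ω ∈ openConn o a).card ∧
    (A.filter fun a => ω ∈ openConn o a).card ≤ j} with hLo1
  set Ho : Set (BondConfig (Fin n)) := {ω | j < (A.filter fun a => ω ∈ openConn o a).card} with hHo
  set Lx : Set (BondConfig (Fin n)) := {ω | (A.filter fun a => ω ∈ openConn x a).card ≤ j} with hLx
  set Hx : Set (BondConfig (Fin n)) := {ω | j < (A.filter fun a => ω ∈ openConn x a).card} with hHx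
  have hmeas : ∀ s : Set (BondConfig (Fin n)), MeasurableSet s := fun _ => MeasurableSet.of_discrete
  -- split `E ∩ Lo` by `x` heavy / light, and `E ∩ Lx` by `o` heavy / light
  have s1 : μ.real (E ∩ Lo) = μ.real (E ∩ Lo ∩ Lx) + μ.real (E ∩ Lo ∩ Hx) := by
    have hc : E ∩ Lo ∩ Hx = (E ∩ Lo) \ Lx := by
      ext ω; simp only [mem_inter_iff, mem_sdiff, hLx, hHx, mem_setOf_eq, not_le]
    rw [hc]; exact (measureReal_inter_add_sdiff (μ := μ) (s := E ∩ Lo) (t := Lx) (hmeas _)).symm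
  have s2 : μ.real (E ∩ Lx) = μ.real (E ∩ Lx ∩ Lo) + μ.real (E ∩ Lx ∩ Ho) := by
    have hc : E ∩ Lx ∩ Ho = (E ∩ Lx) \ Lo := by
      ext ω; simp only [mem_inter_iff, mem_sdiff, hLo, hHo, mem_setOf_eq, not_le]
    rw [hc]; exact (measureReal_inter_add_sdiff (μ := μ) (s := E ∩ Lx) (t := Lo) (hmeas _)).symm
  have e1 : E ∩ Lx ∩ Lo = E ∩ Lo ∩ Lx := by ext ω; simp only [mem_inter_iff]; tauto
  -- a light observer attached to `Q` while `x` is heavy is attached to `Q ∖ x`, with `N ≥ 1`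
  have i1 : E ∩ Lo ∩ Hx ⊆ E' ∩ Lo1 ∩ Hx := by
    rintro ω ⟨⟨⟨y, hy, hoy⟩, hlo⟩, hhx⟩
    have hlo' : (A.filter fun a => ω ∈ openConn o a).card ≤ j := hlo
    have hhx' : j < (A.filter fun a => ω ∈ openConn x a).card := hhx
    have hyx : y ≠ x := by
      rintro rfl
      rw [← filter_eq_of_openConn A hoy] at hhx'
      exact absurd hlo' (not_le.2 hhx')
    have h1 : 1 ≤ (A.filter fun a => ω ∈ openConn o a).card :=
      Finset.card_pos.2 ⟨y, Finset.mem_filter.2 ⟨hQA hy, hoy⟩⟩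
    exact ⟨⟨⟨y, Finset.mem_erase.2 ⟨hyx, hy⟩, hoy⟩, ⟨h1, hlo'⟩⟩, hhx⟩
  have i2 : E' ∩ Ho ∩ Lx ⊆ E ∩ Lx ∩ Ho := by
    rintro ω ⟨⟨⟨y, hy, hoy⟩, hho⟩, hlx⟩
    exact ⟨⟨⟨y, Finset.mem_of_mem_erase hy, hoy⟩, hlx⟩, hho⟩
  have m1 := measureReal_mono (μ := μ) i1 (measure_ne_top μ _)
  have m2 := measureReal_mono (μ := μ) i2 (measure_ne_top μ _)
  have key : μ.real (E' ∩ Lo1 ∩ Hx) ≤ μ.real (E' ∩ Ho ∩ Lx) := hREX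
  rw [s1, s2, e1]
  linarith

/-- **Observer lightness, product form.**  Under the hypotheses of `observer_le_lightest_of_rex`: `μ(E_Q ∩ R_o) ≤ μ(E_Q) · S(x)`
(Harris: `E_Q` is increasing, `R_x` decreasing). [this work] -/
theorem observerLight_of_rex (w : Sym2 (Fin n) → unitInterval) (A Q : Finset (Fin n)) (o x : Fin n) (j : ℕ)
    (hQA : Q ⊆ A) (hx : x ∈ Q)
    (hREX : (prodBernoulli w).real ({ω : BondConfig (Fin n) | ∃ y ∈ Q.erase x, ω ∈ (openConn o y : Set (BondConfig (Fin n)))} ∩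
          {ω | 1 ≤ (A.filter fun a => ω ∈ openConn o a).card ∧ (A.filter fun a => ω ∈ openConn o a).card ≤ j} ∩
          {ω | j < (A.filter fun a => ω ∈ openConn x a).card}) ≤
      (prodBernoulli w).real ({ω : BondConfig (Fin n) | ∃ y ∈ Q.erase x, ω ∈ (openConn o y : Set (BondConfig (Fin n)))} ∩
          {ω | j < (A.filter fun a => ω ∈ openConn o a).card} ∩
          {ω | (A.filter fun a => ω ∈ openConn x a).card ≤ j})) :
    (prodBernoulli w).real ({ω : BondConfig (Fin n) | ∃ y ∈ Q, ω ∈ (openConn o y : Set (BondConfig (Fin n)))} ∩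
        {ω | (A.filter fun a => ω ∈ openConn o a).card ≤ j}) ≤
      (prodBernoulli w).real {ω : BondConfig (Fin n) | ∃ y ∈ Q, ω ∈ (openConn o y : Set (BondConfig (Fin n)))} *
        (prodBernoulli w).real {ω : BondConfig (Fin n) | (A.filter fun a => ω ∈ openConn x a).card ≤ j} :=
  le_trans (observer_le_lightest_of_rex w A Q o x j hQA hx hREX)
    (prodBernoulli_harris_upper_lower w (isUpperSet_attached Q o) (PrefixPacking.isLowerSet_cardLe A x j)
      MeasurableSet.of_discrete MeasurableSet.of_discrete)

/-- **Observer lightness for a pair (unconditional).**  If `x, b ∈ A` and `S(b) ≤ S(x)` then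
`μ({o↔x ∨ o↔b} ∩ R_o) ≤ μ({o↔x ∨ o↔b} ∩ R_x)`. [this work] -/
theorem observer_le_lightest_pair (w : Sym2 (Fin n) → unitInterval) (A : Finset (Fin n)) (o x b : Fin n) (j : ℕ)
    (hxA : x ∈ A) (hbA : b ∈ A) (hxb : x ≠ b)
    (hS : (prodBernoulli w).real {ω : BondConfig (Fin n) | (A.filter fun a => ω ∈ openConn b a).card ≤ j} ≤
      (prodBernoulli w).real {ω : BondConfig (Fin n) | (A.filter fun a => ω ∈ openConn x a).card ≤ j}) :
    (prodBernoulli w).real ({ω : BondConfig (Fin n) | ∃ y ∈ ({x, b} : Finset (Fin n)), ω ∈ (openConn o y : Set (BondConfig (Fin n)))} ∩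
        {ω | (A.filter fun a => ω ∈ openConn o a).card ≤ j}) ≤
      (prodBernoulli w).real ({ω : BondConfig (Fin n) | ∃ y ∈ ({x, b} : Finset (Fin n)), ω ∈ (openConn o y : Set (BondConfig (Fin n)))} ∩
        {ω | (A.filter fun a => ω ∈ openConn x a).card ≤ j}) := by
  have hQA : ({x, b} : Finset (Fin n)) ⊆ A := by
    intro y hy
    rcases Finset.mem_insert.1 hy with rfl | hy
    · exact hxA
    · rw [Finset.mem_singleton.1 hy]; exact hbA
  have hx : x ∈ ({x, b} : Finset (Fin n)) := Finset.mem_insert_self x {b}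
  have herase : ({x, b} : Finset (Fin n)).erase x = {b} := by
    rw [Finset.erase_insert_eq_erase, Finset.erase_eq_of_notMem (by simpa [Finset.mem_singleton] using hxb)]
  refine observer_le_lightest_of_rex w A {x, b} o x j hQA hx ?_
  rw [herase]
  -- REX({b}; x) is the conditioned championship exchange
  have key := conditionedChampionExchange_swap w A o b x j hS
  have e1 : ({ω : BondConfig (Fin n) | ∃ y ∈ ({b} : Finset (Fin n)), ω ∈ (openConn o y : Set (BondConfig (Fin n)))} ∩
          {ω | 1 ≤ (A.filter fun a => ω ∈ openConn o a).card ∧ (A.filter fun a => ω ∈ openConn o a).card ≤ j} ∩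
          {ω | j < (A.filter fun a => ω ∈ openConn x a).card}) ⊆
      ((openConn o b : Set (BondConfig (Fin n))) ∩ {ω | (A.filter fun a => ω ∈ openConn b a).card ≤ j} ∩
        {ω | j < (A.filter fun a => ω ∈ openConn x a).card}) := by
    rintro ω ⟨⟨⟨y, hy, hoy⟩, -, hle⟩, hhx⟩
    rw [Finset.mem_singleton.1 hy] at hoy
    refine ⟨⟨hoy, ?_⟩, hhx⟩
    show (A.filter fun a => ω ∈ openConn b a).card ≤ j
    rw [← filter_eq_of_openConn A hoy]; exact hle
  have e2 : ((openConn o b : Set (BondConfig (Fin n))) ∩ {ω | j < (A.filter fun a => ω ∈ openConn b a).card} ∩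
        {ω | (A.filter fun a => ω ∈ openConn x a).card ≤ j}) ⊆
      ({ω : BondConfig (Fin n) | ∃ y ∈ ({b} : Finset (Fin n)), ω ∈ (openConn o y : Set (BondConfig (Fin n)))} ∩
          {ω | j < (A.filter fun a => ω ∈ openConn o a).card} ∩
          {ω | (A.filter fun a => ω ∈ openConn x a).card ≤ j}) := by
    rintro ω ⟨⟨hob, hb⟩, hlx⟩
    refine ⟨⟨⟨b, Finset.mem_singleton_self b, hob⟩, ?_⟩, hlx⟩
    show j < (A.filter fun a => ω ∈ openConn o a).card
    rw [filter_eq_of_openConn A hob]; exact hb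
  exact le_trans (measureReal_mono e1 (measure_ne_top _ _)) (le_trans key (measureReal_mono e2 (measure_ne_top _ _)))

end ObserverLightness

open ObserverLightness

/-- **An observer attached to a pair of relays is light no more often than the lighter relay** (unconditional):
for `x ≠ b` in `A` with `S(b) ≤ S(x)`,  `μ({o↔x ∨ o↔b} ∩ {|π(o)| ≤ j}) ≤ μ({o↔x ∨ o↔b}) · S(x)`,
i.e. `P(|π(o)| ≤ j | o ↔ {x,b}) ≤ max(S(x), S(b))`. [this work] -/
theorem observerLight_pair (w : Sym2 (Fin n) → unitInterval) (A : Finset (Fin n)) (o x b : Fin n) (j : ℕ)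
    (hxA : x ∈ A) (hbA : b ∈ A) (hxb : x ≠ b)
    (hS : (prodBernoulli w).real {ω : BondConfig (Fin n) | (A.filter fun a => ω ∈ openConn b a).card ≤ j} ≤
      (prodBernoulli w).real {ω : BondConfig (Fin n) | (A.filter fun a => ω ∈ openConn x a).card ≤ j}) :
    (prodBernoulli w).real ({ω : BondConfig (Fin n) | ∃ y ∈ ({x, b} : Finset (Fin n)), ω ∈ (openConn o y : Set (BondConfig (Fin n)))} ∩
        {ω | (A.filter fun a => ω ∈ openConn o a).card ≤ j}) ≤
      (prodBernoulli w).real {ω : BondConfig (Fin n) | ∃ y ∈ ({x, b} : Finset (Fin n)), ω ∈ (openConn o y : Set (BondConfig (Fin n)))} *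
        (prodBernoulli w).real {ω : BondConfig (Fin n) | (A.filter fun a => ω ∈ openConn x a).card ≤ j} :=
  le_trans (observer_le_lightest_pair w A o x b j hxA hbA hxb hS)
    (prodBernoulli_harris_upper_lower w (isUpperSet_attached {x, b} o) (PrefixPacking.isLowerSet_cardLe A x j)
      MeasurableSet.of_discrete MeasurableSet.of_discrete)

end Summit.CriticalPhenomena.PercolationContinuityZ3.Theorems

end
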